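import Summits.QuantumFields.BalabanUV.Beta.GAN24.CombTransportThreeLegs
import Summits.QuantumFields.BalabanUV.Beta.GAN24.Push3Nest

/-!
# `BalabanUV.Beta.GAN24.CombTransportPush` — binder row G-an2-4 ∕ (CONV-C), TRANSFER-III (the G-an2-4 END at row D1's literal of record (III′)), THE FIXED TRANSPORT
# `𝒯 X := κ u ↦ Ψ̂_Sᵀ ∘ slotPsiS r n X κ u ∘ Ψ̂_S` OF M.43 ∕ M.45 IN THE LEG CALCULUS OF THE CT-ROUTE:
# **ON ff-VALUED TABLES `𝒯` IS THE THREE-LEG PUSH `push₃ ψ♭ ψ♭ ψ♭` THROUGH THE CORRECTOR's FIELD BLOCK `ψ♭ α x κ u := Ψ̂_S u x (inl κ) (inl α)` (a leg family at blocking `1`,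
# localised at every rate), HENCE A PUSH THROUGH ANY LEGS AFTER `𝒯` IS ONE PUSH THROUGH THE COMPOSITE LEGS `legComp ψ♭ ·`** — so the (III′) Wilson sector of the S-tower
# (`W′_{j+1} = (cE·wE)•e3OfK G_j (𝒯 W′_j)`, road-P2 `CombCubicStepTransport`) is the (E) one with every dressed leg `R_j` replaced by `R_j ∘ ψ♭` (leaf-01's `push₃_push₃`)
# (G-an2-4 CRUX TEAM (2), seat `b2b-balaban-gan24-p2` = road-P2 chair, gen 55; the leg-calculus form of M.46)

NOT IN PRINT; OUR BOOKKEEPING ([folklore] kernel bookkeeping BY NAME over leaf-01's `GAN24.Push3 ∕ Push3Nest ∕ Push4` (`push₃`, `Lk ∕ Rk ∕ ffRead ∕ vertexW`, `legComp`, `push₃_push₃`, `IsFF`),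
d1-formalise-leaf-03's `SymCorrectorFace.sum_tsum_corrPsiS_indR_mul ∕ slotPsiS_apply_kernel` and `SymCorrectorKernel.psiKS_* ∕ decays_psiKS`, road-P2's M.46 `CombTransportThreeLegs.isFF_conj`;
0 `def`, 0 cited fact, 0 `def … : Prop`, 0 sorry).
HONEST FRAMING (cell contract, verbatim): «discharging `BetaPertH` makes Bałaban's UV stability UNCONDITIONAL — a real constructive-QFT result; it is NOT the continuum
limit and NOT the Clay problem.»  HONEST DEPENDENCY (verbatim): «continuum YM on T⁴ ⇐ BetaPertH ∧ nine spine estimates (0/9 proved); BetaPertH ⇐ (D1) ∧ (D4) ∧ CAP+tail;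
G-an2-4 gates asym, D1 and NE2/3/4.»
ABSOLUTE RULE (cell charter, verbatim): «No internally-minted statement may enter as a cited fact. Every hypothesis is either kernel-proved in this package or a
verbatim quotation of a PUBLISHED theorem with page reference. The manuscript(s) under audit are NOT citable for their own disputed steps — they are the thing under
adjudication; programme-internal (2001/route/tribunal) claims are never citable.»  Nothing is cited here.

## What is proved (generic `d`; `0 < n`, `r ∈ box (d+1) n`, `Ψ̂ = psiKS r n`, `ψ♭ α x κ u := Ψ̂ u x (inl κ) (inl α)` written inline — no `def`)
* §1 `Lk_psiKS_eq` (`Lk ψ♭ = ffRead Ψ̂ᵀ`), `Rk_psiKS_eq` (`Rk ψ♭ = ffRead Ψ̂`), **`vertexW_psiKS_eq_slotPsiS`** (`vertexW ψ♭ S = slotPsiS r n S` for kernel-valued bond families — the slot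
  transport IS the table leg pushed through `ψ♭`), `legDecay_psiKS` (`ψ♭` is a leg family at blocking `1`, localised at every rate `m ≥ 0`).
* §2 `comp_ffRead_left_of_isFF`, `comp_ffRead_right_of_inr_zero`, `isFF_slotPsiS` (bookkeeping).
* §3 **`transport_eq_push₃_of_isFF`**: for an ff-valued table `X`, `Ψ̂ᵀ ∘ slotPsiS r n X κ u ∘ Ψ̂ = push₃ ψ♭ ψ♭ ψ♭ X κ u` (every `κ u`).
* §4 **`push₃_transport_eq_push₃_legComp`**: for leg families `l r w` at blocking `N` localised at a positive rate and an ff-valued LOCAL table `X`,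
  `push₃ l r w (𝒯 X) κ u = push₃ (legComp ψ♭ l) (legComp ψ♭ r) (legComp ψ♭ w) X κ u` (leaf-01's `push₃_push₃`; composite blocking `1·N`).
WHAT THIS IS NOT: no estimate of the composite legs beyond leaf-01's generic `legDecay_legComp` (their j-uniform CELL VALUES — the CT-route's crux at (E), `ContactKernelCells` — at the
composite legs `R_j ∘ ψ♭` are the campaign); NO value, NO rate; NO campaign opened (an2 W-4 stands); NEVER «G-an2-4 closed» as (CONV-C); NOT D1, NOT `BetaPertH`, NOT continuum, NOT Clay.
2026-08-25; no existing file touched.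
-/

noncomputable section

open Finset
open scoped BigOperators
open Literature.MathematicalPhysics.QuantumFieldTheory
open Literature.MathematicalPhysics.QuantumFieldTheory.Balaban1983to89
open Literature.MathematicalPhysics.QuantumFieldTheory.Balaban1983to89.Beta
open B12Sec2to5 (l1 l1_nonneg)
open ExpKernelCalculus (MKer Decays comp)
open AffineAveraging (Site Form1 box toSite)
open OneStepResolventKernel (Fib wsum LocStencil)
open Summit.QuantumFields.BalabanUV.Beta.TameKernelCalculus (trK trK_apply)
open Summit.QuantumFields.BalabanUV.Beta.CompositeCorrectorKernel (kerBound)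
open Summit.QuantumFields.BalabanUV.Beta.SymCorrectorKernel (psiKS psiKS_inl_inl psiKS_inl_inr psiKS_inr_inl psiKS_inr_inr decays_psiKS)
open Summit.QuantumFields.BalabanUV.Beta.SymCorrectorFace (slotPsiS slotPsiS_apply_kernel sum_tsum_corrPsiS_indR_mul)
open Summit.QuantumFields.BalabanUV.Beta.GAN24.Push4 (legComp vertexW vertexW_apply Lk Rk ffRead IsFF Lk_inl_inl Lk_inl_inr Lk_inr Rk_inl_inl Rk_inr_left Rk_inr_right
  ffRead_inl_inl ffRead_inr_left ffRead_inr_right ffRead_eq_self_of_isFF)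
open Summit.QuantumFields.BalabanUV.Beta.GAN24.Push4Bounds (LegDecay)
open Summit.QuantumFields.BalabanUV.Beta.GAN24.Push3 (push₃ push₃_def)
open Summit.QuantumFields.BalabanUV.Beta.GAN24.Push3Nest (push₃_push₃)
open Summit.QuantumFields.BalabanUV.Beta.GAN24.CombTransportThreeLegs (isFF_conj)

namespace Summit.QuantumFields.BalabanUV.Beta.GAN24.CombTransportPush

variable {d : ℕ} {n : ℕ} (hn : 0 < n) {r : Fin (d + 1) → ℕ} (hr : r ∈ box (d + 1) n)
include hn hr

/-! ## §1 The corrector's field block as a leg family -/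

omit hn hr in
/-- [folklore] **THE LEFT LEG KERNEL OF `ψ♭` IS THE ff BLOCK OF `Ψ̂ᵀ`.** -/
theorem Lk_psiKS_eq :
    Lk (fun α x κ u => psiKS r n u x (Sum.inl κ) (Sum.inl α)) = ffRead (trK (psiKS r n)) := by
  funext x' x a b
  rcases a with α | μ
  · rcases b with κ | ν
    · rw [Lk_inl_inl, ffRead_inl_inl, trK_apply]
    · rw [Lk_inl_inr, ffRead_inr_right]
  · rw [Lk_inr, ffRead_inr_left]

omit hn hr in
/-- [folklore] **THE RIGHT LEG KERNEL OF `ψ♭` IS THE ff BLOCK OF `Ψ̂`.** -/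
theorem Rk_psiKS_eq :
    Rk (fun α x κ u => psiKS r n u x (Sum.inl κ) (Sum.inl α)) = ffRead (psiKS r n) := by
  funext z z' a b
  rcases a with κ | μ
  · rcases b with β | ν
    · rw [Rk_inl_inl, ffRead_inl_inl]
    · rw [Rk_inr_right, ffRead_inr_right]
  · rw [Rk_inr_left, ffRead_inr_left]

/-- NOT IN PRINT; OUR BOOKKEEPING ([folklore]).  **THE SLOT TRANSPORT IS THE TABLE LEG PUSHED THROUGH `ψ♭`**: for every kernel-valued bond family `S`,
`vertexW ψ♭ S = slotPsiS r n S` (leaf-03's «face sum of a column of `Ψ_S` against a bond family», entry by entry). -/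
theorem vertexW_psiKS_eq_slotPsiS (S : Fin (d + 1) → Site (d + 1) → MKer (d + 1) (Fib d)) :
    vertexW (fun α x κ u => psiKS r n u x (Sum.inl κ) (Sum.inl α)) S = slotPsiS r n S := by
  funext α x p q a b
  rw [vertexW_apply, slotPsiS_apply_kernel]
  simp only [psiKS_inl_inl]
  exact sum_tsum_corrPsiS_indR_mul hn hr (fun κ u => S κ u p q a b) α x

/-- [folklore] **`ψ♭` IS A LEG FAMILY AT BLOCKING `1`, LOCALISED AT EVERY RATE** (`decays_psiKS`). -/
theorem legDecay_psiKS {m : ℝ} (hm : 0 ≤ m) :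
    ∃ C : ℝ, LegDecay (fun α x κ u => psiKS r n u x (Sum.inl κ) (Sum.inl α)) 1 C m := by
  refine ⟨kerBound (psiKS r n) n * Real.exp (m * (2 * (((d : ℝ) + 1) * n))), fun α x κ u => ?_⟩
  have h := decays_psiKS (d := d) hn hr hm u x (Sum.inl κ) (Sum.inl α)
  simpa only [Nat.cast_one, one_smul] using h

/-! ## §2 Bookkeeping: ff blocks against ff-valued kernels -/

omit hn hr in
/-- [folklore] Against an ff-valued kernel on the right, only the ff block of the left factor matters: `ffRead A ∘ V = A ∘ V` whenever `A`'s multiplier–field block vanishes. -/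
theorem comp_ffRead_left_of_isFF {A V : MKer (d + 1) (Fib d)} (hA : ∀ x z μ κ, A x z (Sum.inr μ) (Sum.inl κ) = 0) (hV : IsFF V) :
    comp (ffRead A) V = comp A V := by
  funext x z a b
  simp only [ExpKernelCalculus.comp]
  refine tsum_congr fun y => ?_
  rw [Fintype.sum_sum_type, Fintype.sum_sum_type]
  simp only [hV.1, mul_zero, Finset.sum_const_zero, add_zero]
  rcases a with α | μ
  · simp only [ffRead_inl_inl]
  · simp only [ffRead_inr_left, hA, zero_mul]

omit hn hr in
/-- [folklore] Against a kernel with vanishing multiplier COLUMNS on the left, only the ff block of the right factor matters: `W ∘ ffRead B = W ∘ B` whenever `B`'s field–multiplier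
block vanishes. -/
theorem comp_ffRead_right_of_inr_zero {W B : MKer (d + 1) (Fib d)} (hW : ∀ x z a μ, W x z a (Sum.inr μ) = 0) (hB : ∀ x z κ μ, B x z (Sum.inl κ) (Sum.inr μ) = 0) :
    comp W (ffRead B) = comp W B := by
  funext x z a b
  simp only [ExpKernelCalculus.comp]
  refine tsum_congr fun y => ?_
  rw [Fintype.sum_sum_type, Fintype.sum_sum_type]
  simp only [hW, zero_mul, Finset.sum_const_zero, add_zero]
  rcases b with β | ν
  · simp only [ffRead_inl_inl]
  · simp only [ffRead_inr_right, hB, mul_zero]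

omit hn hr in
/-- [folklore] The slot transport of an ff-valued table is ff-valued (a finite combination of its entries). -/
theorem isFF_slotPsiS {X : Fin (d + 1) → Site (d + 1) → MKer (d + 1) (Fib d)} (hX : ∀ κ u, IsFF (X κ u)) (κ : Fin (d + 1)) (u : Site (d + 1)) :
    IsFF (slotPsiS r n X κ u) := by
  refine ⟨fun x z μ b => ?_, fun x z a ν => ?_⟩
  · rw [slotPsiS_apply_kernel]
    have h0 : (fun κ' u' => X κ' u' x z (Sum.inr μ) b) = fun _ _ => (0 : ℝ) := by funext κ' u'; exact (hX κ' u').1 _ _ _ _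
    rw [h0]; simp [SymCorrectorFace.slotPsiS_apply]
  · rw [slotPsiS_apply_kernel]
    have h0 : (fun κ' u' => X κ' u' x z a (Sum.inr ν)) = fun _ _ => (0 : ℝ) := by funext κ' u'; exact (hX κ' u').2 _ _ _ _
    rw [h0]; simp [SymCorrectorFace.slotPsiS_apply]

/-! ## §3 On ff-valued tables the fixed transport is the three-leg push through `ψ♭` -/

/-- NOT IN PRINT; OUR BOOKKEEPING ([folklore]; THE LEG-CALCULUS FORM OF `𝒯`).  **`Ψ̂ᵀ ∘ slotPsiS r n X κ u ∘ Ψ̂ = push₃ ψ♭ ψ♭ ψ♭ X κ u`** for every ff-valued table `X`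
(`Lk ψ♭ = ffRead Ψ̂ᵀ`, `Rk ψ♭ = ffRead Ψ̂`, `vertexW ψ♭ = slotPsiS`; the ff blocks act as the full correctors against the ff-valued middle kernel; the result is ff-valued — M.46
`isFF_conj` — so the outer `ffRead` is the identity). -/
theorem transport_eq_push₃_of_isFF {X : Fin (d + 1) → Site (d + 1) → MKer (d + 1) (Fib d)} (hX : ∀ κ u, IsFF (X κ u)) (κ : Fin (d + 1)) (u : Site (d + 1)) :
    comp (comp (trK (psiKS r n)) (slotPsiS r n X κ u)) (psiKS r n)
      = push₃ (fun α x κ u => psiKS r n u x (Sum.inl κ) (Sum.inl α)) (fun α x κ u => psiKS r n u x (Sum.inl κ) (Sum.inl α))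
          (fun α x κ u => psiKS r n u x (Sum.inl κ) (Sum.inl α)) X κ u := by
  have hV : IsFF (slotPsiS r n X κ u) := isFF_slotPsiS hX κ u
  rw [push₃_def, Lk_psiKS_eq, Rk_psiKS_eq, vertexW_psiKS_eq_slotPsiS hn hr]
  -- left: the ff block of `Ψ̂ᵀ` against the ff-valued slot transport is `Ψ̂ᵀ` itself
  rw [comp_ffRead_left_of_isFF (fun x z μ κ' => by rw [trK_apply, psiKS_inl_inr]) hV]
  -- right: `Ψ̂ᵀ ∘ V` has vanishing multiplier columns, so the ff block of `Ψ̂` acts as `Ψ̂`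
  have hW : ∀ x z a μ, comp (trK (psiKS r n)) (slotPsiS r n X κ u) x z a (Sum.inr μ) = 0 := fun x z a μ => by
    show (∑' y, ∑ f, trK (psiKS r n) x y a f * slotPsiS r n X κ u y z f (Sum.inr μ)) = 0
    simp only [hV.2, mul_zero, Finset.sum_const_zero, tsum_zero]
  rw [comp_ffRead_right_of_inr_zero hW (fun x z κ' μ => psiKS_inl_inr (r := r) (n := n) (x := x) (y := z) κ' μ),
    ffRead_eq_self_of_isFF (isFF_conj hn hr hV)]

/-! ## §4 A push after the transport is one push through the composite legs -/

/-- NOT IN PRINT; OUR BOOKKEEPING ([folklore]; THE CT-ROUTE READING).  **A THREE-LEG PUSH AFTER `𝒯` IS ONE PUSH THROUGH THE COMPOSITE LEGS `legComp ψ♭ ·`**: for leg families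
`l r w` at blocking `N` localised at a positive rate `m`, and an ff-valued LOCAL table `X` (`0 < δ`), every `κ u`:
`push₃ l r w (κ u ↦ Ψ̂ᵀ ∘ slotPsiS r n X κ u ∘ Ψ̂) κ u = push₃ (legComp ψ♭ l) (legComp ψ♭ r) (legComp ψ♭ w) X κ u` (§3 + leaf-01's `push₃_push₃`, inner blocking `1`).
So the (III′) Wilson lineage `W′_{j+1} = (cE·wE)•e3OfK G_j (𝒯 W′_j)` (road-P2 `CombCubicStepTransport.ScombOf_succ_eq_bm_transport`) reads, in the CT-route's units where
`e3K` of an ff-valued table is `push₃ R_j R_j R_j` (leaf-03 `SrecWilsonSector.e3K_coDressKBmAt_KStepUnit_of_isFF`), as the (E) one with EVERY dressed leg `R_j` replaced by `R_j ∘ ψ♭`. -/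
theorem push₃_transport_eq_push₃_legComp {l r' w : Fin (d + 1) → (Fin (d + 1) → ℤ) → Fin (d + 1) → (Fin (d + 1) → ℤ) → ℝ} {N : ℕ} {Cl Cr Cw m : ℝ}
    (hl : LegDecay l N Cl m) (hr' : LegDecay r' N Cr m) (hw : LegDecay w N Cw m) (hm : 0 < m)
    {X : Fin (d + 1) → Site (d + 1) → MKer (d + 1) (Fib d)} (hX : ∀ κ u, IsFF (X κ u)) {C δ : ℝ} (hXl : LocStencil X C δ) (hδ : 0 < δ)
    (κ : Fin (d + 1)) (u : Site (d + 1)) :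
    push₃ l r' w (fun κ u => comp (comp (trK (psiKS r n)) (slotPsiS r n X κ u)) (psiKS r n)) κ u
      = push₃ (legComp (fun α x κ u => psiKS r n u x (Sum.inl κ) (Sum.inl α)) l)
          (legComp (fun α x κ u => psiKS r n u x (Sum.inl κ) (Sum.inl α)) r')
          (legComp (fun α x κ u => psiKS r n u x (Sum.inl κ) (Sum.inl α)) w) X κ u := by
  obtain ⟨Cψ, hψ⟩ := legDecay_psiKS (d := d) hn hr (le_of_lt one_pos)
  have e : (fun κ u => comp (comp (trK (psiKS r n)) (slotPsiS r n X κ u)) (psiKS r n))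
      = push₃ (fun α x κ u => psiKS r n u x (Sum.inl κ) (Sum.inl α)) (fun α x κ u => psiKS r n u x (Sum.inl κ) (Sum.inl α))
          (fun α x κ u => psiKS r n u x (Sum.inl κ) (Sum.inl α)) X := by
    funext κ u; exact transport_eq_push₃_of_isFF hn hr hX κ u
  rw [e]
  exact push₃_push₃ hl hr' hw hψ hψ hψ hm one_pos hXl hδ κ u

end Summit.QuantumFields.BalabanUV.Beta.GAN24.CombTransportPush

end
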